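import Literature.AlgebraicTopology.KTheory.Clutching
import Literature.AlgebraicTopology.KTheory.HomotopyInvariance
import Literature.AlgebraicTopology.KTheory.GLHomotopyExtension
import Literature.AlgebraicTopology.KTheory.Products
import Literature.LinearAlgebra.Matrix.GLPathConnected
import HarnessLib

/-!
# Idempotents over a union of two contractible closed pieces; `K⁰ = ℤ` criteria

Let `X = X₁ ∪ X₂` be compact Hausdorff, covered by two closed *contractible* subspaces with
overlap `A = X₁ ∩ X₂ ∋ a₀`, and suppose every continuous `g : A → GLᵣ(ℂ)` is homotopic through
such maps to the constant `1` (e.g. `A` discrete: `exists_nullhomotopy_of_discrete`, by path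
connectedness of `GLᵣ(ℂ)`, `GLPathConnected.lean`). Then every idempotent matrix over `C(X, ℂ)`
is algebraically equivalent to the constant `1ᵣ` (`algEquivalent_one_of_cover`), hence
`rank_{a₀} : K⁰(X) → ℤ` is bijective (`rankAt_bijective_of_cover`). This is the trivial case
(null-homotopic clutching functions) of the clutching classification of bundles over a union of
two contractible pieces (Hatcher, *VBKT* Prop. 1.11; Husemöller, *Fibre Bundles*, Ch. 11
Prop. 2.3), and gives `K̃(S¹) = 0` (`SphereCaps.lean`). Ingredients: trivialisation over each
piece (`algEquivalent_one_of_contractible`, homotopy invariance), the transition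
`g = y₁ x₂ : A → GLᵣ(ℂ)`, its extension over `X₂` (`exists_extension_of_homotopic_one`), the
corrected trivialisation and gluing (`algEquivalent_of_cover`). Also: `invFamily` (pointwise
inverse of an invertible matrix family). Everything is proved; no named facts.

## References

* D. Husemöller, *Fibre Bundles*, 3rd ed. (1994) [HusemollerFibreBundles1994]: Ch. 11 Prop. 2.3
  (bundles over a union via clutching), Thm. 5.5 (`K̃(S¹) = 0` input).
* D. Husemöller et al., *Basic Bundle Theory and K-Cohomology Invariants* (2008)
  [HusemollerEtAl2008]: Ch. 6 Cor. 6.5 (homotopy invariance).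
-/

noncomputable section

namespace Literature.AlgebraicTopology.KTheory

open Literature.RingTheory.KTheory Matrix Set unitInterval

universe u

/-! ### Pointwise inverses -/

/-- The pointwise inverse of a continuous family of invertible complex matrices, as a continuous
family. [folklore] -/
def invFamily {Y : Type*} [TopologicalSpace Y] {n : Type*} [Fintype n] [DecidableEq n]
    (G : C(Y, Matrix n n ℂ)) (hG : ∀ y, IsUnit (G y).det) : C(Y, Matrix n n ℂ) where
  toFun y := (G y)⁻¹
  continuous_toFun := continuous_iff_continuousAt.2 fun y ↦
    (continuousAt_matrix_inv (G y) (by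
      rw [Ring.inverse_eq_inv']
      exact continuousAt_inv₀ (hG y).ne_zero)).comp G.continuous.continuousAt

/-- Values of `invFamily`. [folklore] -/
@[simp] theorem invFamily_apply {Y : Type*} [TopologicalSpace Y] {n : Type*} [Fintype n] [DecidableEq n]
    (G : C(Y, Matrix n n ℂ)) (hG : ∀ y, IsUnit (G y).det) (y : Y) : invFamily G hG y = (G y)⁻¹ := rfl

/-! ### Contractible pieces -/

/-- Over a compact contractible space every idempotent matrix is algebraically equivalent to the
constant free idempotent `1ᵣ`, `r` its rank at any point (homotopy invariance + rank normal form).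
[cite: HusemollerEtAl2008, Ch. 6 Cor. 6.5] -/
theorem algEquivalent_one_of_contractible {Y : Type*} [TopologicalSpace Y] [CompactSpace Y] [ContractibleSpace Y]
    (y : Y) (p : Idem C(Y, ℂ)) :
    AlgEquivalent p.mat (1 : Matrix (Fin (p.map (evalRingHom y)).rank) (Fin (p.map (evalRingHom y)).rank) C(Y, ℂ)) := by
  have h1 : p ≈ p.map (comapRingHom (ContinuousMap.const Y y)) := equiv_map_const_of_contractible y p
  rw [comapRingHom_const, ← Idem.map_map] at h1
  have h2 := AlgEquivalent.map (constRingHom Y) (Idem.equiv_iff.1 (p.map (evalRingHom y)).equiv_unit_rank)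
  rw [← Matrix.map_one (constRingHom Y) (map_zero _) (map_one _)]
  exact (Idem.equiv_iff.1 h1).trans h2

/-! ### The main theorem -/

variable {X : Type u} [TopologicalSpace X] [CompactSpace X] [T2Space X]

/-- **Idempotents over a union of two contractible closed pieces with "unknotted" overlap are
trivial.** Let `X = X₁ ∪ X₂` be compact Hausdorff, covered by closed contractible subspaces whose
overlap `A = X₁ ∩ X₂` contains `a₀` and has the property that every continuous invertible-valued
`g : A → Mᵣ(ℂ)` is homotopic through such maps to the constant `1`. Then every idempotent matrix
over `C(X, ℂ)` is algebraically equivalent to the constant `1ᵣ`, `r` its rank at `a₀`: trivialise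
over `X₁` and `X₂` (contractibility), compare the trivialisations on `A` by `g = y₁ x₂ : A → GLᵣ(ℂ)`,
extend `g` over `X₂` (`exists_extension_of_homotopic_one`), correct the second trivialisation by
the extension and glue (`algEquivalent_of_cover`). With `X = S¹`, `A = S⁰` this is `K̃(S¹) = 0`;
it is the trivial case of the clutching classification `Vect(X₁ ∪ X₂) ↔ [A, GLᵣ]` (Hatcher,
*VBKT* Prop. 1.11; Husemöller, *Fibre Bundles*, Ch. 9 §7–8).
[cite: HusemollerFibreBundles1994, Ch. 11 Prop. 2.3] -/
theorem algEquivalent_one_of_cover {X₁ X₂ : Set X} (h₁ : IsClosed X₁) (h₂ : IsClosed X₂) (hcov : X₁ ∪ X₂ = univ)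
    [ContractibleSpace X₁] [ContractibleSpace X₂] {a₀ : X} (ha₀ : a₀ ∈ X₁ ∩ X₂)
    (hA : ∀ (r : ℕ) (g : C(↥(X₁ ∩ X₂), Matrix (Fin r) (Fin r) ℂ)), (∀ a, IsUnit (g a).det) →
      ∃ F : C(↥(X₁ ∩ X₂) × I, Matrix (Fin r) (Fin r) ℂ),
        (∀ z, IsUnit (F z).det) ∧ (∀ a, F (a, 0) = g a) ∧ ∀ a, F (a, 1) = 1)
    (p : Idem C(X, ℂ)) :
    AlgEquivalent p.mat (1 : Matrix (Fin (p.map (evalRingHom a₀)).rank) (Fin (p.map (evalRingHom a₀)).rank) C(X, ℂ)) := by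
  classical
  haveI : CompactSpace X₁ := isCompact_iff_compactSpace.1 h₁.isCompact
  haveI : CompactSpace X₂ := isCompact_iff_compactSpace.1 h₂.isCompact
  set A : Set X := X₁ ∩ X₂
  set r := (p.map (evalRingHom a₀)).rank
  set ρ₁ := resHom (X := X) X₁
  set ρ₂ := resHom (X := X) X₂
  set σ₁ : C(X₁, ℂ) →+* C(A, ℂ) := resHomOfSubset inter_subset_left
  set σ₂ : C(X₂, ℂ) →+* C(A, ℂ) := resHomOfSubset inter_subset_right
  have hσρ : σ₁.comp ρ₁ = σ₂.comp ρ₂ := by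
    rw [resHomOfSubset_comp_resHom, resHomOfSubset_comp_resHom]
  -- Step 1: trivialise over the pieces (types normalised to `Fin p.size`)
  set P₁ : Matrix (Fin p.size) (Fin p.size) C(X₁, ℂ) := p.mat.map ρ₁
  set P₂ : Matrix (Fin p.size) (Fin p.size) C(X₂, ℂ) := p.mat.map ρ₂
  have e₁ : AlgEquivalent P₁ (1 : Matrix (Fin r) (Fin r) C(X₁, ℂ)) :=
    algEquivalent_one_of_contractible (⟨a₀, ha₀.1⟩ : X₁) (p.map ρ₁)
  have e₂ : AlgEquivalent P₂ (1 : Matrix (Fin r) (Fin r) C(X₂, ℂ)) :=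
    algEquivalent_one_of_contractible (⟨a₀, ha₀.2⟩ : X₂) (p.map ρ₂)
  obtain ⟨x₁, y₁, hxy₁, hyx₁, hpx₁, -, -, hyp₁⟩ := e₁.exists_normalized
  obtain ⟨x₂, y₂, hxy₂, hyx₂, hpx₂, -, -, hyp₂⟩ := e₂.exists_normalized
  -- Step 2: the transition `g = y₁ x₂` over `A`
  set g : Matrix (Fin r) (Fin r) C(A, ℂ) := y₁.map σ₁ * x₂.map σ₂
  set g' : Matrix (Fin r) (Fin r) C(A, ℂ) := y₂.map σ₂ * x₁.map σ₁
  have hPA : P₁.map σ₁ = P₂.map σ₂ := by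
    change (p.mat.map ρ₁).map σ₁ = (p.mat.map ρ₂).map σ₂
    rw [Matrix.map_map, Matrix.map_map]
    have := congrArg (fun φ : C(X, ℂ) →+* C(A, ℂ) ↦ p.mat.map φ) hσρ
    simpa only [RingHom.coe_comp] using this
  have hgg' : g * g' = 1 := by
    calc g * g' = y₁.map σ₁ * (x₂.map σ₂ * y₂.map σ₂) * x₁.map σ₁ := by
          simp only [g, g', Matrix.mul_assoc]
      _ = y₁.map σ₁ * (P₁.map σ₁) * x₁.map σ₁ := by rw [← Matrix.map_mul, hxy₂, hPA]
      _ = (y₁ * P₁ * x₁).map σ₁ := by rw [Matrix.map_mul, Matrix.map_mul]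
      _ = 1 := by rw [hyp₁, hyx₁, Matrix.map_one _ (map_zero _) (map_one _)]
  have hg'g : g' * g = 1 := by
    calc g' * g = y₂.map σ₂ * (x₁.map σ₁ * y₁.map σ₁) * x₂.map σ₂ := by
          simp only [g, g', Matrix.mul_assoc]
      _ = y₂.map σ₂ * (P₂.map σ₂) * x₂.map σ₂ := by rw [← Matrix.map_mul, hxy₁, hPA]
      _ = (y₂ * P₂ * x₂).map σ₂ := by rw [Matrix.map_mul, Matrix.map_mul]
      _ = 1 := by rw [hyp₂, hyx₂, Matrix.map_one _ (map_zero _) (map_one _)]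
  -- as a continuous family, with invertible values
  have hginv : ∀ a : A, IsUnit (matrixSwap g a).det := fun a ↦ by
    have : matrixSwap g a * matrixSwap g' a = 1 := by rw [← matrixSwap_mul, hgg', matrixSwap_one]
    exact Matrix.isUnit_det_of_right_inverse this
  -- Step 3: extend `g` over `X₂`
  obtain ⟨F, hF, hF0, hF1⟩ := hA r (matrixSwap g) hginv
  -- transport to the closed subset `A' = X₁ ∩ X₂` seen inside `X₂`
  let A' : Set X₂ := Subtype.val ⁻¹' X₁
  have hA' : IsClosed A' := h₁.preimage continuous_subtype_val
  let ι : C(A', A) := ⟨fun a ↦ ⟨a.1.1, a.2, a.1.2⟩, by fun_prop⟩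
  obtain ⟨G, hG, hGA⟩ := exists_extension_of_homotopic_one hA' ((matrixSwap g).comp ι)
    (F.comp (ι.prodMap (ContinuousMap.id I))) (fun z ↦ hF _) (fun a ↦ hF0 _) (fun a ↦ hF1 _)
  set Gm : Matrix (Fin r) (Fin r) C(X₂, ℂ) := matrixUnswap G
  set Gm' : Matrix (Fin r) (Fin r) C(X₂, ℂ) := matrixUnswap (invFamily G hG)
  have hGm : Gm * Gm' = 1 := matrixSwap_injective <| by
    ext x : 1
    rw [matrixSwap_mul, matrixSwap_one]
    change matrixSwap (matrixUnswap G) x * matrixSwap (matrixUnswap (invFamily G hG)) x = 1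
    rw [show matrixSwap (matrixUnswap G) = G from (matrixSwapEquiv _ _ _).right_inv G,
      show matrixSwap (matrixUnswap (invFamily G hG)) = invFamily G hG from (matrixSwapEquiv _ _ _).right_inv _]
    exact Matrix.mul_nonsing_inv _ (hG x)
  have hGm' : Gm' * Gm = 1 := matrixSwap_injective <| by
    ext x : 1
    rw [matrixSwap_mul, matrixSwap_one]
    change matrixSwap (matrixUnswap (invFamily G hG)) x * matrixSwap (matrixUnswap G) x = 1
    rw [show matrixSwap (matrixUnswap G) = G from (matrixSwapEquiv _ _ _).right_inv G,
      show matrixSwap (matrixUnswap (invFamily G hG)) = invFamily G hG from (matrixSwapEquiv _ _ _).right_inv _]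
    exact Matrix.nonsing_inv_mul _ (hG x)
  have hGmσ : Gm.map σ₂ = g := by
    ext i j a : 3
    change G ⟨a.1, a.2.2⟩ i j = g i j a
    rw [hGA ⟨⟨a.1, a.2.2⟩, a.2.1⟩]
    rfl
  have hGm'σ : Gm'.map σ₂ = g' := by
    have h1 : Gm'.map σ₂ * g = 1 := by rw [← hGmσ, ← Matrix.map_mul, hGm', Matrix.map_one _ (map_zero _) (map_one _)]
    calc Gm'.map σ₂ = Gm'.map σ₂ * (g * g') := by rw [hgg', Matrix.mul_one]
      _ = g' := by rw [← Matrix.mul_assoc, h1, Matrix.one_mul]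
  -- Step 4: corrected trivialisation over `X₂`
  set x₂' := x₂ * Gm'
  set y₂' := Gm * y₂
  have hxy₂' : x₂' * y₂' = P₂ := by
    calc x₂' * y₂' = x₂ * (Gm' * Gm) * y₂ := by simp only [x₂', y₂', Matrix.mul_assoc]
      _ = _ := by rw [hGm', Matrix.mul_one, hxy₂]
  have hyx₂' : y₂' * x₂' = 1 := by
    calc y₂' * x₂' = Gm * (y₂ * x₂) * Gm' := by simp only [x₂', y₂', Matrix.mul_assoc]
      _ = 1 := by rw [hyx₂, Matrix.mul_one, hGm]
  -- Step 5: the two trivialisations now agree on `A`; glue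
  have hx : x₁.map σ₁ = x₂'.map σ₂ := by
    rw [Matrix.map_mul, hGm'σ]
    change x₁.map σ₁ = x₂.map σ₂ * (y₂.map σ₂ * x₁.map σ₁)
    rw [← Matrix.mul_assoc, ← Matrix.map_mul, hxy₂, ← hPA, ← Matrix.map_mul, hpx₁]
  have hy : y₁.map σ₁ = y₂'.map σ₂ := by
    rw [Matrix.map_mul, hGmσ]
    change y₁.map σ₁ = y₁.map σ₁ * x₂.map σ₂ * y₂.map σ₂
    rw [Matrix.mul_assoc, ← Matrix.map_mul, hxy₂, ← hPA, ← Matrix.map_mul, hyp₁]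
  refine algEquivalent_of_cover h₁ h₂ hcov p.isIdempotentElem IsIdempotentElem.one x₁ y₁ x₂' y₂' hxy₁ ?_ hxy₂' ?_ hx hy
  · rw [hyx₁, Matrix.map_one _ (map_zero _) (map_one _)]
  · rw [hyx₂', Matrix.map_one _ (map_zero _) (map_one _)]

/-- **`K⁰(X) = ℤ` by the rank** under the hypotheses of `algEquivalent_one_of_cover`
(e.g. `K⁰(S¹) = ℤ`, i.e. `K̃⁰(S¹) = 0`; Husemöller, *Fibre Bundles*, Ch. 9 (5.2)). [cite: HusemollerFibreBundles1994, Ch. 11 Thm. 5.5] -/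
theorem rankAt_bijective_of_cover {X₁ X₂ : Set X} (h₁ : IsClosed X₁) (h₂ : IsClosed X₂) (hcov : X₁ ∪ X₂ = univ)
    [ContractibleSpace X₁] [ContractibleSpace X₂] {a₀ : X} (ha₀ : a₀ ∈ X₁ ∩ X₂)
    (hA : ∀ (r : ℕ) (g : C(↥(X₁ ∩ X₂), Matrix (Fin r) (Fin r) ℂ)), (∀ a, IsUnit (g a).det) →
      ∃ F : C(↥(X₁ ∩ X₂) × I, Matrix (Fin r) (Fin r) ℂ),
        (∀ z, IsUnit (F z).det) ∧ (∀ a, F (a, 0) = g a) ∧ ∀ a, F (a, 1) = 1) :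
    Function.Bijective (rankAt a₀ : K0 X → ℤ) := by
  have key : ∀ p : Idem C(X, ℂ), KZero.of p = KZero.unitHom _ (rankAt a₀ (KZero.of p)) := fun p ↦ by
    rw [rankAt_of, ← KZero.of_unit_eq_unitHom]
    exact KZero.of_eq_of (algEquivalent_one_of_cover h₁ h₂ hcov ha₀ hA p)
  constructor
  · intro a b hab
    obtain ⟨p, q, rfl⟩ := KZero.exists_of_sub_of a
    obtain ⟨p', q', rfl⟩ := KZero.exists_of_sub_of b
    rw [key p, key q, key p', key q', ← map_sub, ← map_sub, ← map_sub, ← map_sub]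
    exact congrArg _ hab
  · intro k
    exact ⟨KZero.unitHom _ k, rankAt_unitHom a₀ k⟩

/-- The hypothesis of `algEquivalent_one_of_cover` holds when the overlap is discrete (e.g.
finite, like `S⁰ ⊆ S¹`): a family of invertible matrices on a discrete space is joined to `1`
pointwise, by paths in the path-connected `GLᵣ(ℂ)`. [folklore] -/
theorem exists_nullhomotopy_of_discrete {A : Type*} [TopologicalSpace A] [DiscreteTopology A] {r : ℕ}
    (g : C(A, Matrix (Fin r) (Fin r) ℂ)) (hg : ∀ a, IsUnit (g a).det) :
    ∃ F : C(A × I, Matrix (Fin r) (Fin r) ℂ), (∀ z, IsUnit (F z).det) ∧ (∀ a, F (a, 0) = g a) ∧ ∀ a, F (a, 1) = 1 := by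
  choose γ hγ using fun a ↦ Literature.LinearAlgebra.Matrix.joinedIn_isUnit_det (hg a) (by simp : IsUnit (1 : Matrix (Fin r) (Fin r) ℂ).det)
  refine ⟨⟨fun z ↦ γ z.1 z.2, continuous_prod_of_discrete_left.2 fun a ↦ (γ a).continuous⟩,
    fun z ↦ hγ z.1 z.2, fun a ↦ (γ a).source, fun a ↦ (γ a).target⟩

end Literature.AlgebraicTopology.KTheory

end
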